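import Summits.QuantumFields.YangMills.Theorems.LuscherReductionTwistedTraceScalingLatticeGnChart
import HarnessLib

/-!
# Integrands supported in the upper hemispheres see only the vacuum pattern of the lattice gnomonic chart:
# `∫ g dσ^{⊗E} = ∫ (∏_e w(w_e)) · g(P(w)) dw` when `g(V) = 0` as soon as some link has `scalarPart(V_e) ≤ 0`
# (lane B of S-BASE, crux `TwistedTraceScaling` stmt-QuantumFields-20203; the Laplace step of both COARSE lanes)

`…LatticeGnChart.integral_configMeasure_eq_sum_latPatternChart` writes every integral over `SU(2)^E` as a sum over the `2^{|E|}` hemisphere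
patterns `z : Edge → Bool`.  The near-vacuum integrands of the COARSE programme (bulk cut-off `‖V_e − 1‖_F ≤ r < √2` on every link, i.e.
`scalarPart(V_e) > 0`) vanish on every pattern other than the vacuum pattern `z ≡ false`, because a link `negOne · P(1,w_e)` has negative scalar
part.  So for them the sum collapses to ONE Lebesgue integral over `(Edge 3 L → ℝ³)` with the explicit density `∏_e (2π²)⁻¹(1+|w_e|²)⁻²`:
`integral_configMeasure_eq_vacuumChart`.  Also: `scalarPart_latPatternChart_neg` (lower-hemisphere links of a non-vacuum pattern) and the
Frobenius criterion `scalarPart_pos_of_frobNorm_sq_lt_four` (`‖U − 1‖_F² < 4 ⇒ scalarPart U > 0`).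
HONEST FRAMING: bookkeeping; femto rung R2b1 (stub of a child of a CONDITIONAL route); not a gap, not Clay.
-/

set_option autoImplicit false

noncomputable section

open MeasureTheory Filter Topology Real
open scoped ENNReal BigOperators
open Literature.MathematicalPhysics.QuantumFieldTheory
open Literature.MathematicalPhysics.QuantumLattice
open Literature.MathematicalPhysics.QuantumFieldTheory.Balaban1983to89.T4CubeChartGnomonic (gnoPoint gnoWeight
  gnoWeight_pos gnoWeight_le measurable_gnoWeight continuous_gnoPoint)

namespace Summit.QuantumFields.YangMills.Theorems.FemtoTransferGap.TwoLattice.GnChart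

open Summit.QuantumFields.YangMills.Theorems.FemtoTransferGap

variable (L : ℕ) [NeZero L]

/-- A link in the Frobenius ball of radius `< 2` about `1` lies in the open upper hemisphere: `‖U − 1‖_F² < 4 ⇒ 0 < scalarPart U`.
[folklore] -/
theorem scalarPart_pos_of_frobNorm_sq_lt_four (U : SU2) (h : frobNorm ((U : Matrix (Fin 2) (Fin 2) ℂ) - 1) ^ 2 < 4) : 0 < scalarPart U := by
  rw [frobNorm_sub_one_sq_eq_scalarPart] at h; linarith

omit [NeZero L] in
/-- On a pattern with `z e = true` the link `e` of the chart configuration lies in the LOWER hemisphere. [folklore] -/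
theorem scalarPart_latPatternChart_neg {z : Edge 3 L → Bool} {e : Edge 3 L} (he : z e = true) (w : Edge 3 L → Fin 3 → ℝ) :
    scalarPart (latPatternChart L z w e) < 0 := by
  simp only [latPatternChart, hemiChart, he, hemi, if_true]
  rw [scalarPart_negOne_mul]
  have := scalarPart_gnoPoint_pos (w e)
  linarith

omit [NeZero L] in
/-- A pattern other than the vacuum pattern has a `true` link. [folklore] -/
theorem exists_true_of_ne_vacuum {z : Edge 3 L → Bool} (hz : z ≠ fun _ => false) : ∃ e, z e = true := by
  by_contra h
  push Not at h
  exact hz (funext fun e => by simpa using h e)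

/-- ★ **Collapse to the vacuum pattern**: if the bounded measurable `g` vanishes on every configuration having a link with non-positive scalar
part, then `∫ g dσ^{⊗E} = ∫ (∏_e w(w_e)) · g(latPatternChart (fun _ ↦ false) w) dw`. [folklore] -/
theorem integral_configMeasure_eq_vacuumChart {g : GaugeConfig 3 L SU2 → ℝ} (hg : Measurable g) (hb : ∃ C : ℝ, ∀ U, |g U| ≤ C)
    (h0 : ∀ V : GaugeConfig 3 L SU2, (∃ e, scalarPart (V e) ≤ 0) → g V = 0) :
    ∫ U, g U ∂(configMeasure SU2 L) =
      ∫ w, latGnDensityReal L w * g (latPatternChart L (fun _ => false) w) ∂volume := by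
  rw [integral_configMeasure_eq_sum_latPatternChart L hg hb]
  rw [Finset.sum_eq_single (fun _ : Edge 3 L => false)]
  · intro z _ hz
    obtain ⟨e, he⟩ := exists_true_of_ne_vacuum L hz
    refine integral_eq_zero_of_ae (ae_of_all _ fun w => ?_)
    show latGnDensityReal L w * g (latPatternChart L z w) = 0
    rw [h0 _ ⟨e, (scalarPart_latPatternChart_neg L he w).le⟩, mul_zero]
  · intro h; exact absurd (Finset.mem_univ _) h

/-- The same collapse for integrands supported in the Frobenius balls `‖V_e − 1‖_F² < 4` (e.g. the bulk cut-offs `‖V_e − 1‖_F ≤ r`, `r < 2`).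
[folklore] -/
theorem integral_configMeasure_eq_vacuumChart_of_frobNorm {g : GaugeConfig 3 L SU2 → ℝ} (hg : Measurable g) (hb : ∃ C : ℝ, ∀ U, |g U| ≤ C)
    (h0 : ∀ V : GaugeConfig 3 L SU2, (∃ e, 4 ≤ frobNorm ((V e : Matrix (Fin 2) (Fin 2) ℂ) - 1) ^ 2) → g V = 0) :
    ∫ U, g U ∂(configMeasure SU2 L) =
      ∫ w, latGnDensityReal L w * g (latPatternChart L (fun _ => false) w) ∂volume := by
  refine integral_configMeasure_eq_vacuumChart L hg hb fun V ⟨e, he⟩ => h0 V ⟨e, ?_⟩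
  rw [frobNorm_sub_one_sq_eq_scalarPart]; linarith

omit [NeZero L] in
/-- On the vacuum pattern the chart links are `P(1, w_e)`: scalar part `(1+|w_e|²)^{-1/2} > 0`, gnomonic coordinate `gnLink = w_e`. [folklore] -/
theorem gnLink_latPatternChart_false (w : Edge 3 L → Fin 3 → ℝ) (e : Edge 3 L) :
    gnLink (latPatternChart L (fun _ => false) w e) = w e ∧ 0 < scalarPart (latPatternChart L (fun _ => false) w e) := by
  rw [latPatternChart_false]
  exact ⟨gnLink_gnoPoint (w e), scalarPart_gnoPoint_pos (w e)⟩

end Summit.QuantumFields.YangMills.Theorems.FemtoTransferGap.TwoLattice.GnChart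

end
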